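import Literature.Topology.FourManifolds.CellEngulfingFromEngulfing
import HarnessLib

/-!
# Engulfing with charts inside the ambient open set, and from the manifold form of Theorem 4.12.1

Interface file of the engulfing line for the named fact
`Literature.Topology.FourManifolds.nonempty_homeomorph_sphere_of_five_le` (spc4.S14; T. B.
Rushing, *Topological embeddings* (1973), Cor. 4.13.2).  `CellEngulfingFromEngulfing.lean`
consumes Rushing's **Topological Engulfing Theorem 4.12.1** as a hypothesis in a chart form for
the open subsets `M'` of the ambient manifold, with the compact polyhedron read through an open
chart `e : ℝⁿ → Y` of which only `e(|T|) ⊆ M'` is required.  This file proves that two more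
convenient forms of 4.12.1 imply that one, so that a proof of the theorem in either form closes
the line:

* §2 `engulfing_of_engulfing_local`: it suffices to engulf polyhedra read through charts whose
  whole image lies in `M'` — by a fine subdivision (Lebesgue number of `|T| ⊆ e⁻¹(M')`,
  `exists_refinement_diam_le`) and an induction over the simplices, each read through the small
  chart `e ∘ coreSqueeze x (δ₀/4)` (§1: an open self-embedding of `ℝⁿ` onto the ball
  `B(x, δ₀/2)`, the identity on `B̄(x, δ₀/4)`, `isOpenEmbedding_coreSqueeze`), keeping the
  simplices already engulfed fixed and transporting `U` with its monotone connectivity along the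
  homeomorphisms already found (`MonotonicallyConnected.image_homeomorph`);
* §3 `engulfingLocal_of_manifold`: that local form follows from Theorem 4.12.1 stated for
  topological `n`-manifolds `N` **as types** (connected, Hausdorff, second countable, charted on
  `ℝⁿ`; `(N, U)` monotonically `(n - 3)`-connected; conclusion a compactly supported
  homeomorphism — Rushing's compact set `E`), applied to the open submanifold `N = M'`
  (`TopologicalSpace.Opens.instChartedSpace`): relative and monotone connectivity restrict to
  the subspace (`IsRelConnected.preimage_subtypeVal`,
  `MonotonicallyConnected.preimage_subtypeVal`) and a compactly supported homeomorphism of an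
  open subspace extends by the identity (`exists_homeomorph_extend_subtype`) — exactly Rushing's
  own use of 4.12.1 in Lemma 4.13.1, for `M - (g_A(A × [0, 1 - ε]) ∪ B)`.

Everything is proved; no named fact is introduced (the definitions `coreSqueezeFactor`,
`coreUnsqueezeFactor`, `coreSqueeze`, `coreUnsqueeze` have bodies).

## References

* T. B. Rushing, *Topological embeddings*, Pure and Applied Mathematics 52, Academic Press
  (1973), Thm. 4.12.1 (p. 201) and its use in Engulfing Lemma 4.13.1 (p. 207). [Rushing1973]
-/

open Set Function Metric Topology

noncomputable section

namespace Literature.Topology.FourManifolds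

open Literature.Analysis.Convexity

/-! ### §1 The core squeeze: an open self-embedding of a normed space into a ball, the identity on a smaller ball -/

section Squeeze

variable {W : Type*} [NormedAddCommGroup W] [NormedSpace ℝ W]

/-- Radial factor of the squeeze: `1` up to `r`, `(2 r u - r²)/u²` beyond (new radius
`2r - r²/u`). [folklore] -/
def coreSqueezeFactor (r u : ℝ) : ℝ := if u ≤ r then 1 else (2 * r * u - r ^ 2) / u ^ 2

/-- Radial factor of the inverse of the squeeze on the ball of radius `2r`: `1` up to `r`,
`r² / ((2r - v) v)` beyond. [folklore] -/
def coreUnsqueezeFactor (r v : ℝ) : ℝ := if v ≤ r then 1 else r ^ 2 / ((2 * r - v) * v)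

/-- Continuity of the squeeze factor (`r > 0`). [folklore] -/
theorem continuous_coreSqueezeFactor {r : ℝ} (hr : 0 < r) : Continuous (coreSqueezeFactor r) := by
  unfold coreSqueezeFactor
  refine continuous_if_le continuous_id continuous_const continuousOn_const ?_ fun u hu => ?_
  · refine ContinuousOn.div (by fun_prop) (by fun_prop) fun u hu => ?_
    have : r ≤ u := hu
    exact pow_ne_zero 2 (hr.trans_le this).ne'
  · rw [hu]
    field_simp
    ring
/-- Continuity of the inverse factor on `[0, 2r)` (indeed on `(-∞, 2r)`), `r > 0`. [folklore] -/
theorem continuousOn_coreUnsqueezeFactor {r : ℝ} (hr : 0 < r) :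
    ContinuousOn (coreUnsqueezeFactor r) (Iio (2 * r)) := by
  unfold coreUnsqueezeFactor
  refine ContinuousOn.if ?_ continuousOn_const ?_
  · rintro v ⟨-, hv⟩
    have hv' : v = r := by
      have := frontier_le_subset_eq continuous_id continuous_const hv
      exact this
    rw [hv']
    field_simp
    ring
  · refine ContinuousOn.div continuousOn_const (by fun_prop) ?_
    rintro v ⟨hv2, hvr⟩
    have hv2' : v < 2 * r := hv2
    have hvr' : r ≤ v := by
      have : v ∈ closure {v : ℝ | ¬ v ≤ r} := hvr
      rw [show {v : ℝ | ¬ v ≤ r} = Ioi r by ext; simp, closure_Ioi] at this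
      exact this
    have : 0 < 2 * r - v := by linarith
    exact (mul_pos this (hr.trans_le hvr')).ne'

/-- **The core squeeze** about `x` with radii `r < 2r`: `z ↦ x + λ(‖z - x‖) (z - x)`.
[folklore] -/
def coreSqueeze (x : W) (r : ℝ) (z : W) : W := x + coreSqueezeFactor r ‖z - x‖ • (z - x)

/-- The inverse of the core squeeze on the ball of radius `2r`. [folklore] -/
def coreUnsqueeze (x : W) (r : ℝ) (w : W) : W := x + coreUnsqueezeFactor r ‖w - x‖ • (w - x)

variable {x : W} {r : ℝ}

/-- Continuity of the squeeze. [folklore] -/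
theorem continuous_coreSqueeze (hr : 0 < r) : Continuous (coreSqueeze x r) :=
  continuous_const.add (((continuous_coreSqueezeFactor hr).comp (continuous_id.sub
    continuous_const).norm).smul (continuous_id.sub continuous_const))

/-- The squeeze is the identity on the closed `r`-ball. [folklore] -/
theorem coreSqueeze_of_le {z : W} (hz : ‖z - x‖ ≤ r) : coreSqueeze x r z = z := by
  simp [coreSqueeze, coreSqueezeFactor, hz]

/-- The squeeze factor is positive (`r > 0`). [folklore] -/
theorem coreSqueezeFactor_pos (hr : 0 < r) (u : ℝ) : 0 < coreSqueezeFactor r u := by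
  unfold coreSqueezeFactor
  split_ifs with h
  · exact one_pos
  · have : r < u := lt_of_not_ge h
    have h1 : 0 < 2 * r * u - r ^ 2 := by nlinarith
    exact div_pos h1 (pow_pos (hr.trans this) 2)

/-- The new radius. [folklore] -/
theorem norm_coreSqueeze_sub (hr : 0 < r) (z : W) :
    ‖coreSqueeze x r z - x‖ = coreSqueezeFactor r ‖z - x‖ * ‖z - x‖ := by
  rw [coreSqueeze, add_sub_cancel_left, norm_smul,
    Real.norm_of_nonneg (coreSqueezeFactor_pos hr _).le]

/-- The new radius is `< 2r`. [folklore] -/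
theorem norm_coreSqueeze_sub_lt (hr : 0 < r) (z : W) : ‖coreSqueeze x r z - x‖ < 2 * r := by
  rw [norm_coreSqueeze_sub hr]
  unfold coreSqueezeFactor
  split_ifs with h
  · linarith
  · have hu : r < ‖z - x‖ := lt_of_not_ge h
    have hu0 : 0 < ‖z - x‖ := hr.trans hu
    have hne : ‖z - x‖ ≠ 0 := hu0.ne'
    have key : (2 * r * ‖z - x‖ - r ^ 2) / ‖z - x‖ ^ 2 * ‖z - x‖ = 2 * r - r ^ 2 / ‖z - x‖ := by
      field_simp
    rw [key]
    have : 0 < r ^ 2 / ‖z - x‖ := by positivity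
    linarith

/-- The squeeze maps into the open `2r`-ball. [folklore] -/
theorem coreSqueeze_mem_ball (hr : 0 < r) (z : W) : coreSqueeze x r z ∈ ball x (2 * r) := by
  rw [mem_ball, dist_eq_norm]
  exact norm_coreSqueeze_sub_lt hr z

/-- Left inverse: unsqueezing a squeezed point. [folklore] -/
theorem coreUnsqueeze_coreSqueeze (hr : 0 < r) (z : W) :
    coreUnsqueeze x r (coreSqueeze x r z) = z := by
  by_cases hz : ‖z - x‖ ≤ r
  · rw [coreSqueeze_of_le hz, coreUnsqueeze]
    simp [coreUnsqueezeFactor, hz]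
  · have hu : r < ‖z - x‖ := lt_of_not_ge hz
    set u := ‖z - x‖ with hu'
    have hu0 : 0 < u := hr.trans hu
    have hfac : coreSqueezeFactor r u = (2 * r * u - r ^ 2) / u ^ 2 := by simp [coreSqueezeFactor, hz]
    have hv : ‖coreSqueeze x r z - x‖ = 2 * r - r ^ 2 / u := by
      rw [norm_coreSqueeze_sub hr, ← hu', hfac]
      field_simp
    have hvr : ¬ 2 * r - r ^ 2 / u ≤ r := by
      intro h
      have h1 : r ^ 2 / u < r := by
        rw [div_lt_iff₀ hu0]
        nlinarith
      linarith
    rw [coreUnsqueeze, hv, coreSqueeze, add_sub_cancel_left, smul_smul]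
    have hne : 2 * r * u - r ^ 2 ≠ 0 := by nlinarith
    have hne2 : u * 2 - r ≠ 0 := by nlinarith
    have hu0' : u ≠ 0 := hu0.ne'
    have hprod : coreUnsqueezeFactor r (2 * r - r ^ 2 / u) * coreSqueezeFactor r u = 1 := by
      rw [hfac]
      simp only [coreUnsqueezeFactor, hvr, if_false]
      rw [show 2 * r - (2 * r - r ^ 2 / u) = r ^ 2 / u by ring,
        show 2 * r - r ^ 2 / u = (2 * r * u - r ^ 2) / u by field_simp]
      field_simp
    rw [← hu', hprod, one_smul, add_sub_cancel]

/-- Right inverse on the open `2r`-ball. [folklore] -/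
theorem coreSqueeze_coreUnsqueeze (hr : 0 < r) {w : W} (hw : w ∈ ball x (2 * r)) :
    coreSqueeze x r (coreUnsqueeze x r w) = w := by
  rw [mem_ball, dist_eq_norm] at hw
  by_cases hv : ‖w - x‖ ≤ r
  · have h1 : coreUnsqueeze x r w = w := by simp [coreUnsqueeze, coreUnsqueezeFactor, hv]
    rw [h1, coreSqueeze_of_le hv]
  · have hvr : r < ‖w - x‖ := lt_of_not_ge hv
    set v := ‖w - x‖ with hv'
    have hv0 : 0 < v := hr.trans hvr
    have h2rv : 0 < 2 * r - v := by linarith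
    have hfac : coreUnsqueezeFactor r v = r ^ 2 / ((2 * r - v) * v) := by simp [coreUnsqueezeFactor, hv]
    have hfac0 : 0 < coreUnsqueezeFactor r v := by rw [hfac]; positivity
    have hu : ‖coreUnsqueeze x r w - x‖ = r ^ 2 / (2 * r - v) := by
      rw [coreUnsqueeze, add_sub_cancel_left, norm_smul, Real.norm_of_nonneg hfac0.le, ← hv', hfac]
      field_simp
    have hur : ¬ r ^ 2 / (2 * r - v) ≤ r := by
      intro h
      rw [div_le_iff₀ h2rv] at h
      nlinarith
    rw [coreSqueeze, hu, coreUnsqueeze, add_sub_cancel_left, smul_smul]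
    have h1 : (2 * r - v) ≠ 0 := h2rv.ne'
    have h2 : v ≠ 0 := hv0.ne'
    have h3 : r ≠ 0 := hr.ne'
    have hprod : coreSqueezeFactor r (r ^ 2 / (2 * r - v)) * coreUnsqueezeFactor r v = 1 := by
      rw [hfac]
      simp only [coreSqueezeFactor, hur, if_false]
      field_simp
      ring
    rw [← hv', hprod, one_smul, add_sub_cancel]

/-- Continuity of the inverse on the open `2r`-ball. [folklore] -/
theorem continuousOn_coreUnsqueeze (hr : 0 < r) :
    ContinuousOn (coreUnsqueeze x r) (ball x (2 * r)) := by
  refine continuousOn_const.add (ContinuousOn.smul ?_ (continuousOn_id.sub continuousOn_const))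
  refine (continuousOn_coreUnsqueezeFactor hr).comp (continuous_id.sub continuous_const).norm.continuousOn
    fun w hw => ?_
  rw [mem_ball, dist_eq_norm] at hw
  exact hw

/-- **The core squeeze is an open embedding** (`r > 0`): continuous, with a continuous inverse
on its open image, the `2r`-ball. [folklore] -/
theorem isOpenEmbedding_coreSqueeze (hr : 0 < r) : IsOpenEmbedding (coreSqueeze x r) := by
  refine IsOpenEmbedding.of_continuous_injective_isOpenMap (continuous_coreSqueeze hr)
    (fun z₁ z₂ h => ?_) fun V hV => ?_
  · rw [← coreUnsqueeze_coreSqueeze hr z₁, h, coreUnsqueeze_coreSqueeze hr]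
  · have : coreSqueeze x r '' V = ball x (2 * r) ∩ coreUnsqueeze x r ⁻¹' V := by
      ext w
      constructor
      · rintro ⟨z, hz, rfl⟩
        exact ⟨coreSqueeze_mem_ball hr z, by rw [mem_preimage, coreUnsqueeze_coreSqueeze hr]; exact hz⟩
      · rintro ⟨hw, hwV⟩
        exact ⟨_, hwV, coreSqueeze_coreUnsqueeze hr hw⟩
    rw [this]
    exact (continuousOn_coreUnsqueeze hr).isOpen_inter_preimage isOpen_ball hV

/-- The image of the squeeze lies in the `2r`-ball. [folklore] -/
theorem range_coreSqueeze_subset (hr : 0 < r) : range (coreSqueeze x r) ⊆ ball x (2 * r) := by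
  rintro _ ⟨z, rfl⟩
  exact coreSqueeze_mem_ball hr z

end Squeeze

/-! ### §2 Engulfing with small charts suffices -/

section Local

variable {n : ℕ} {Y : Type*} [TopologicalSpace Y]

/-- A homeomorphism which is the identity off a set maps that set onto itself. [folklore] -/
theorem image_eq_self_of_forall_not_mem {M' : Set Y} (g : Y ≃ₜ Y) (hg : ∀ y, y ∉ M' → g y = y) :
    g '' M' = M' := by
  have key : ∀ (h : Y ≃ₜ Y), (∀ y, y ∉ M' → h y = y) → ∀ y ∈ M', h y ∈ M' := fun h hh y hy => by
    by_contra hcon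
    have h1 : h (h y) = h y := hh _ hcon
    rw [h.injective h1] at hcon
    exact hcon hy
  have hg' : ∀ y, y ∉ M' → g.symm y = y := fun y hy => by
    rw [g.symm_apply_eq]
    exact (hg y hy).symm
  refine Subset.antisymm ?_ fun y hy => ⟨g.symm y, key g.symm hg' y hy, g.apply_symm_apply y⟩
  rintro _ ⟨y, hy, rfl⟩
  exact key g hg y hy

/-- **Engulfing with charts inside the ambient open set suffices.** In the chart form of
Rushing's Topological Engulfing Theorem 4.12.1 used by `cellEngulfing_of_engulfing` (open subset
`M'`, open `U ⊆ M'`, `(M', U)` connected and monotonically `(n - 3)`-connected, a compact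
polyhedron `e|T|` of dimension `≤ n - 3` read through an open chart `e : ℝⁿ → Y` with
`e|T| ⊆ M'`, a compact `C ⊆ U` ⟹ a homeomorphism supported in `M'`, fixing `C`, engulfing
`e|T|` by `U`), it is enough to know the statement for charts `e` whose *whole image* lies in
`M'`: subdivide `T` so finely that every closed simplex lies in a ball `B(x, δ₀/4)` with
`B(x, δ₀) ⊆ e⁻¹(M')` (Lebesgue number, `exists_refinement_diam_le`), and engulf the simplices
one at a time, each read through the small chart `e ∘ coreSqueeze x (δ₀/4)` (an open embedding
with image in `e(B(x, δ₀/2)) ⊆ M'`, the identity on the simplex), keeping the compact set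
`C ∪ (simplices already engulfed)` fixed and transporting `U` and its monotone connectivity along
the homeomorphisms already constructed (`MonotonicallyConnected.image_homeomorph`).  This is
the reduction that lets a proof of Theorem 4.12.1 *for manifolds* (applied to the open
submanifold `M'`, with charts into `M'`) feed `cellEngulfing_of_engulfing`. [cite: Rushing1973, Thm. 4.12.1 (use in Lemma 4.13.1)] -/
theorem engulfing_of_engulfing_local (n : ℕ)
    (hEngL : ∀ (M' U : Set Y), IsOpen M' → IsOpen U → U ⊆ M' → IsConnected M' →
      MonotonicallyConnected (n - 3) M' U →
      ∀ (e : EuclideanSpace ℝ (Fin n) → Y), IsOpenEmbedding e → range e ⊆ M' →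
      ∀ (T : Geometry.SimplicialComplex ℝ (EuclideanSpace ℝ (Fin n))), T.faces.Finite →
        (∀ F ∈ T.faces, F.card ≤ n - 2) →
      ∀ C : Set Y, IsCompact C → C ⊆ U →
        ∃ g : Y ≃ₜ Y, (∀ y, y ∉ M' → g y = y) ∧ (∀ y ∈ C, g y = y) ∧ e '' T.space ⊆ g '' U)
    (M' U : Set Y) (hM'o : IsOpen M') (hUo : IsOpen U) (hUM' : U ⊆ M') (hconn : IsConnected M')
    (hmono : MonotonicallyConnected (n - 3) M' U)
    (e : EuclideanSpace ℝ (Fin n) → Y) (he : IsOpenEmbedding e)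
    (T : Geometry.SimplicialComplex ℝ (EuclideanSpace ℝ (Fin n))) (hT : T.faces.Finite)
    (hcard : ∀ F ∈ T.faces, F.card ≤ n - 2) (hTM' : e '' T.space ⊆ M')
    (C : Set Y) (hC : IsCompact C) (hCU : C ⊆ U) :
    ∃ g : Y ≃ₜ Y, (∀ y, y ∉ M' → g y = y) ∧ (∀ y ∈ C, g y = y) ∧ e '' T.space ⊆ g '' U := by
  classical
  -- Lebesgue number of `|T| ⊆ e⁻¹(M')` and a fine subdivision
  have hO : IsOpen (e ⁻¹' M') := hM'o.preimage he.continuous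
  have hTO : T.space ⊆ ⋃ _ : Unit, e ⁻¹' M' := by
    rw [iUnion_const]
    exact fun x hx => hTM' ⟨x, hx, rfl⟩
  obtain ⟨δ₀, hδ₀, hδ₀O⟩ := lebesgue_number_lemma_of_metric (isCompact_space_of_finite hT)
    (fun _ => hO) hTO
  obtain ⟨P, hPfin, hPsp, hPref, -, hPdiam⟩ :=
    exists_refinement_diam_le T hT (by positivity : (0 : ℝ) < δ₀ / 4)
  have hPcard : ∀ s ∈ P.faces, s.card ≤ n - 2 := fun s hs => by
    obtain ⟨t, ht, hst⟩ := hPref s hs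
    exact (card_le_of_convexHull_subset hs hst).trans (hcard t ht)
  -- engulf the simplices of `P` one at a time
  suffices key : ∀ S : Finset (Finset (EuclideanSpace ℝ (Fin n))), (↑S : Set _) ⊆ P.faces →
      ∃ g : Y ≃ₜ Y, (∀ y, y ∉ M' → g y = y) ∧ (∀ y ∈ C, g y = y) ∧
        ∀ s ∈ S, e '' convexHull ℝ (s : Set (EuclideanSpace ℝ (Fin n))) ⊆ g '' U by
    obtain ⟨g, hg1, hg2, hg3⟩ := key hPfin.toFinset (by simp)
    refine ⟨g, hg1, hg2, ?_⟩
    rintro _ ⟨x, hx, rfl⟩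
    rw [← hPsp] at hx
    obtain ⟨s, hs, hxs⟩ := Geometry.SimplicialComplex.mem_space_iff.1 hx
    exact hg3 s (hPfin.mem_toFinset.2 hs) ⟨x, hxs, rfl⟩
  intro S
  induction S using Finset.induction_on with
  | empty =>
    intro _
    exact ⟨Homeomorph.refl Y, fun _ _ => rfl, fun _ _ => rfl, by simp⟩
  | insert a S haS ih =>
    intro hS
    rw [Finset.coe_insert] at hS
    obtain ⟨g, hg1, hg2, hg3⟩ := ih ((subset_insert _ _).trans hS)
    have ha : a ∈ P.faces := hS (mem_insert _ _)
    -- the transported open set and the enlarged compact set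
    have hgM' : g '' M' = M' := image_eq_self_of_forall_not_mem g hg1
    have hU'o : IsOpen (g '' U) := g.isOpenMap _ hUo
    have hU'M' : g '' U ⊆ M' := hgM' ▸ image_mono hUM'
    have hmono' : MonotonicallyConnected (n - 3) M' (g '' U) := by
      have := hmono.image_homeomorph g
      rwa [hgM'] at this
    set C' : Set Y := C ∪ ⋃ s ∈ S, e '' convexHull ℝ (s : Set (EuclideanSpace ℝ (Fin n))) with hC'
    have hC'c : IsCompact C' := hC.union (S.finite_toSet.isCompact_biUnion fun s _ =>
      (s.finite_toSet.isCompact_convexHull ℝ).image he.continuous)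
    have hC'U : C' ⊆ g '' U := union_subset (fun y hy => ⟨y, hCU hy, hg2 y hy⟩)
      (iUnion₂_subset fun s hs => hg3 s hs)
    -- the small chart about the new simplex
    obtain ⟨x, hxa⟩ := P.nonempty_of_mem_faces ha
    have hxT : x ∈ T.space := hPsp ▸ P.subset_space ha (Finset.mem_coe.2 hxa)
    obtain ⟨_, hballO⟩ := hδ₀O x hxT
    have hδ4 : (0 : ℝ) < δ₀ / 4 := by positivity
    set σ : EuclideanSpace ℝ (Fin n) → EuclideanSpace ℝ (Fin n) := coreSqueeze x (δ₀ / 4) with hσ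
    have hσe : IsOpenEmbedding σ := isOpenEmbedding_coreSqueeze hδ4
    have he' : IsOpenEmbedding (e ∘ σ) := he.comp hσe
    have hrange : range (e ∘ σ) ⊆ M' := by
      rintro _ ⟨z, rfl⟩
      refine hballO (ball_subset_ball (by linarith) (coreSqueeze_mem_ball hδ4 z))
    have hσid : ∀ y ∈ convexHull ℝ (a : Set (EuclideanSpace ℝ (Fin n))), σ y = y := fun y hy =>
      coreSqueeze_of_le (by
        rw [← dist_eq_norm]
        exact (dist_comm y x).le.trans
          ((hPdiam a ha x (subset_convexHull ℝ _ (Finset.mem_coe.2 hxa)) y hy).trans_eq' (by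
            rw [dist_eq_norm])))
    -- the complex of the new simplex and its faces
    set Ta := downClosure P ({a} : Set (Finset (EuclideanSpace ℝ (Fin n)))) with hTa
    have hTafin : Ta.faces.Finite := hPfin.subset downClosure_le
    have hTacard : ∀ F ∈ Ta.faces, F.card ≤ n - 2 := fun F hF => hPcard F (downClosure_le hF)
    have hTasp : Ta.space = convexHull ℝ (a : Set (EuclideanSpace ℝ (Fin n))) := by
      refine Subset.antisymm (fun y hy => ?_) fun y hy => mem_space_downClosure_iff.2 ⟨a, rfl, ha, hy⟩
      obtain ⟨s, hs, -, hys⟩ := mem_space_downClosure_iff.1 hy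
      rw [mem_singleton_iff.1 hs] at hys
      exact hys
    have himage : (e ∘ σ) '' Ta.space = e '' convexHull ℝ (a : Set (EuclideanSpace ℝ (Fin n))) := by
      rw [hTasp, image_comp]
      congr 1
      refine Subset.antisymm ?_ fun y hy => ⟨y, hy, hσid y hy⟩
      rintro _ ⟨y, hy, rfl⟩
      rwa [hσid y hy]
    -- engulf it
    obtain ⟨g₂, hg₂1, hg₂2, hg₂3⟩ := hEngL M' (g '' U) hM'o hU'o hU'M' hconn hmono' (e ∘ σ) he'
      hrange Ta hTafin hTacard C' hC'c hC'U
    refine ⟨g.trans g₂, fun y hy => ?_, fun y hy => ?_, fun s hs => ?_⟩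
    · rw [Homeomorph.trans_apply, hg1 y hy, hg₂1 y hy]
    · rw [Homeomorph.trans_apply, hg2 y hy, hg₂2 y (Or.inl hy)]
    · have htr : (g.trans g₂) '' U = g₂ '' (g '' U) := by
        simp only [image_image, Homeomorph.trans_apply]
      rw [htr]
      rcases Finset.mem_insert.1 hs with rfl | hs'
      · rw [← himage]
        exact hg₂3
      · intro y hy
        have hyC' : y ∈ C' := Or.inr (mem_biUnion hs' hy)
        exact ⟨y, hg3 s hs' hy, hg₂2 y hyC'⟩

end Local

/-! ### §3 From the Topological Engulfing Theorem for manifolds to engulfing inside open subsets -/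

section Manifold

variable {n : ℕ} {Y : Type*} [TopologicalSpace Y]

/-- **Relative connectivity passes to an open (indeed any) subspace containing the pair.**
[folklore] -/
theorem IsRelConnected.preimage_subtypeVal {M' X A : Set Y} (hXM : X ⊆ M') {r : ℕ}
    (h : IsRelConnected r X A) :
    IsRelConnected r ((↑) ⁻¹' X : Set M') ((↑) ⁻¹' A) := by
  intro i hi f hfX hfA
  let f' : C(EuclideanSpace ℝ (Fin i), Y) := ⟨fun x => (f x : Y), continuous_subtype_val.comp f.continuous⟩
  obtain ⟨H', hH'0, hH'X, hH'A, hH'1⟩ := h i hi f' (fun x hx => hfX hx) (fun x hx => hfA hx)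
  -- retract the parameter space onto `D × I`, where `H'` takes values in `X ⊆ M'`
  set retr : EuclideanSpace ℝ (Fin i) × ℝ → EuclideanSpace ℝ (Fin i) × ℝ :=
    fun z => (ballRetract z.1, ((projIcc 0 1 zero_le_one z.2 : Icc (0 : ℝ) 1) : ℝ)) with hretr
  have hretrc : Continuous retr := (continuous_ballRetract.comp continuous_fst).prodMk
    (continuous_subtype_val.comp (continuous_projIcc.comp continuous_snd))
  have hmem : ∀ z, retr z ∈ closedBall (0 : EuclideanSpace ℝ (Fin i)) 1 ×ˢ Icc (0 : ℝ) 1 :=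
    fun z => ⟨ballRetract_mem z.1, (projIcc 0 1 zero_le_one z.2).2⟩
  have hid : ∀ z ∈ closedBall (0 : EuclideanSpace ℝ (Fin i)) 1 ×ˢ Icc (0 : ℝ) 1, retr z = z :=
    fun z hz => Prod.ext (ballRetract_of_mem hz.1) (by
      show ((projIcc 0 1 zero_le_one z.2 : Icc (0 : ℝ) 1) : ℝ) = z.2
      rw [projIcc_of_mem _ hz.2])
  have hval : ∀ z, H' (retr z) ∈ M' := fun z => hXM (hH'X (hmem z))
  let H : C(EuclideanSpace ℝ (Fin i) × ℝ, M') :=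
    ⟨fun z => ⟨H' (retr z), hval z⟩, (H'.continuous.comp hretrc).subtype_mk _⟩
  refine ⟨H, fun x hx => Subtype.ext ?_, fun z hz => ?_, fun z hz => ?_, fun x hx => ?_⟩
  · show H' (retr (x, 0)) = f x
    rw [hid (x, 0) ⟨hx, left_mem_Icc.2 zero_le_one⟩]
    exact hH'0 x hx
  · show H' (retr z) ∈ X
    rw [hid z hz]
    exact hH'X hz
  · show H' (retr z) ∈ A
    rw [hid z ⟨sphere_subset_closedBall hz.1, hz.2⟩]
    exact hH'A hz
  · show H' (retr (x, 1)) ∈ A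
    rw [hid (x, 1) ⟨hx, right_mem_Icc.2 zero_le_one⟩]
    exact hH'1 x hx

/-- **Monotone connectivity passes to the open subspace.** [folklore] -/
theorem MonotonicallyConnected.preimage_subtypeVal {M' U : Set Y} {r : ℕ}
    (h : MonotonicallyConnected r M' U) (hUM : U ⊆ M') :
    MonotonicallyConnected r (univ : Set M') ((↑) ⁻¹' U) := by
  intro C₁ hC₁ hC₁U
  have hC₁' : IsCompact (((↑) : M' → Y) '' C₁) := hC₁.image continuous_subtype_val
  have hC₁'U : ((↑) : M' → Y) '' C₁ ⊆ U := by
    rintro _ ⟨x, hx, rfl⟩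
    exact hC₁U hx
  obtain ⟨C₂, h12, h2U, hcl, hrel⟩ := h _ hC₁' hC₁'U
  refine ⟨(↑) ⁻¹' C₂, fun x hx => h12 ⟨x, hx, rfl⟩, ⟨preimage_mono h2U.1, fun hsub => h2U.2 ?_⟩,
    ?_, ?_⟩
  · intro u hu
    have : (⟨u, hUM hu⟩ : M') ∈ ((↑) ⁻¹' U : Set M') := hu
    exact hsub this
  · rintro x ⟨hx, -⟩
    have h1 : (x : Y) ∈ closure C₂ := continuous_subtype_val.closure_preimage_subset C₂ hx
    exact hcl ⟨h1, x.2⟩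
  · have hX : M' \ C₂ ⊆ M' := sdiff_subset
    have := hrel.preimage_subtypeVal (M' := M') hX
    have e1 : ((↑) ⁻¹' (M' \ C₂) : Set M') = univ \ (↑) ⁻¹' C₂ := by
      ext x
      simp
    have e2 : ((↑) ⁻¹' (U \ C₂) : Set M') = (↑) ⁻¹' U \ (↑) ⁻¹' C₂ := by
      ext x
      simp
    rwa [e1, e2] at this

variable [T2Space Y]

/-- **Extension by the identity of a compactly supported homeomorphism of an open subspace.**
[folklore] -/
theorem exists_homeomorph_extend_subtype {M' : Set Y} (hM' : IsOpen M') (g : M' ≃ₜ M')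
    {K : Set M'} (hK : IsCompact K) (hgK : ∀ y, y ∉ K → g y = y) :
    ∃ G : Y ≃ₜ Y, (∀ (y : Y) (hy : y ∈ M'), G y = g ⟨y, hy⟩) ∧ ∀ y, y ∉ M' → G y = y := by
  classical
  have hgK' : ∀ y, y ∉ K → g.symm y = y := fun y hy => by
    rw [g.symm_apply_eq]
    exact (hgK y hy).symm
  -- the extension of a self-map of `M'` fixing the complement of `K`
  let ext : (M' → M') → Y → Y := fun φ y => if h : y ∈ M' then (φ ⟨y, h⟩ : Y) else y
  have hext_in : ∀ (φ : M' → M') (y : Y) (hy : y ∈ M'), ext φ y = φ ⟨y, hy⟩ := fun φ y hy => by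
    simp only [ext, dif_pos hy]
  have hext_out : ∀ (φ : M' → M') (y : Y), y ∉ M' → ext φ y = y := fun φ y hy => by
    simp only [ext, dif_neg hy]
  have hcont : ∀ φ : M' → M', Continuous φ → (∀ y, y ∉ K → φ y = y) → Continuous (ext φ) := by
    intro φ hφ hφK
    rw [continuous_iff_continuousAt]
    intro y
    by_cases hy : y ∈ M'
    · have hon : ContinuousOn (ext φ) M' := by
        rw [continuousOn_iff_continuous_restrict]
        have : M'.restrict (ext φ) = fun x : M' => (φ x : Y) := by
          funext x
          exact hext_in φ x x.2
        rw [this]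
        exact continuous_subtype_val.comp hφ
      exact hon.continuousAt (hM'.mem_nhds hy)
    · have hKc : IsClosed (((↑) : M' → Y) '' K) := (hK.image continuous_subtype_val).isClosed
      have hyK : y ∉ ((↑) : M' → Y) '' K := fun ⟨x, _, hxy⟩ => hy (hxy ▸ x.2)
      have : ext φ =ᶠ[nhds y] id := by
        filter_upwards [hKc.isOpen_compl.mem_nhds hyK] with z hz
        by_cases hzM : z ∈ M'
        · rw [hext_in φ z hzM, hφK ⟨z, hzM⟩ fun h => hz ⟨_, h, rfl⟩]
          rfl
        · exact hext_out φ z hzM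
      exact (continuousAt_congr this).2 continuousAt_id
  have hinv : ∀ (φ ψ : M' → M'), (∀ x, φ (ψ x) = x) → ∀ y, ext φ (ext ψ y) = y := by
    intro φ ψ hφψ y
    by_cases hy : y ∈ M'
    · rw [hext_in ψ y hy, hext_in φ _ (ψ ⟨y, hy⟩).2]
      simp [hφψ]
    · rw [hext_out ψ y hy, hext_out φ y hy]
  let G : Y ≃ₜ Y :=
    { toFun := ext g
      invFun := ext g.symm
      left_inv := hinv g.symm g fun x => g.symm_apply_apply x
      right_inv := hinv g g.symm fun x => g.apply_symm_apply x
      continuous_toFun := hcont g g.continuous hgK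
      continuous_invFun := hcont g.symm g.symm.continuous hgK' }
  exact ⟨G, fun y hy => hext_in g y hy, fun y hy => hext_out g y hy⟩

universe u

/-- **Engulfing inside open subsets from the Topological Engulfing Theorem for manifolds.** IF
Rushing's Topological Engulfing Theorem 4.12.1 holds in chart form for (Hausdorff,
second-countable, connected) topological `n`-manifolds `N` as types (binder `hTL`: `U ⊆ N` open
with `(N, U)` monotonically `(n - 3)`-connected, a compact polyhedron `e|T|` of dimension
`≤ n - 3` read through an open chart `e : ℝⁿ → N`, a compact `C ⊆ U` ⟹ a compactly supported
homeomorphism of `N` fixing `C` with `e|T| ⊆ g(U)` — `(M, U, f(P), C, E, e₁)` of 4.12.1 with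
`Q = ∅`), THEN the local chart form for the open subsets `M'` of a manifold `Y` used by
`engulfing_of_engulfing_local` holds: apply `hTL` to the open submanifold `N = M'`
(`TopologicalSpace.Opens.instChartedSpace`), to which the chart, the compact set and the monotone
connectivity restrict (`MonotonicallyConnected.preimage_subtypeVal`), and extend the resulting
compactly supported homeomorphism of `M'` by the identity (`exists_homeomorph_extend_subtype`).
[cite: Rushing1973, Thm. 4.12.1] -/
theorem engulfingLocal_of_manifold {Y : Type u} [TopologicalSpace Y] [T2Space Y]
    [SecondCountableTopology Y] [ChartedSpace (EuclideanSpace ℝ (Fin n)) Y]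
    (hTL : ∀ (N : Type u) [TopologicalSpace N] [T2Space N] [SecondCountableTopology N]
      [ChartedSpace (EuclideanSpace ℝ (Fin n)) N] [ConnectedSpace N],
      ∀ U : Set N, IsOpen U → MonotonicallyConnected (n - 3) univ U →
      ∀ (e : EuclideanSpace ℝ (Fin n) → N), IsOpenEmbedding e →
      ∀ (T : Geometry.SimplicialComplex ℝ (EuclideanSpace ℝ (Fin n))), T.faces.Finite →
        (∀ F ∈ T.faces, F.card ≤ n - 2) →
      ∀ C : Set N, IsCompact C → C ⊆ U →
        ∃ g : N ≃ₜ N, (∃ K : Set N, IsCompact K ∧ ∀ y, y ∉ K → g y = y) ∧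
          (∀ y ∈ C, g y = y) ∧ e '' T.space ⊆ g '' U)
    (M' U : Set Y) (hM'o : IsOpen M') (hUo : IsOpen U) (hUM' : U ⊆ M') (hconn : IsConnected M')
    (hmono : MonotonicallyConnected (n - 3) M' U)
    (e : EuclideanSpace ℝ (Fin n) → Y) (he : IsOpenEmbedding e) (hrange : range e ⊆ M')
    (T : Geometry.SimplicialComplex ℝ (EuclideanSpace ℝ (Fin n))) (hT : T.faces.Finite)
    (hcard : ∀ F ∈ T.faces, F.card ≤ n - 2)
    (C : Set Y) (hC : IsCompact C) (hCU : C ⊆ U) :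
    ∃ g : Y ≃ₜ Y, (∀ y, y ∉ M' → g y = y) ∧ (∀ y ∈ C, g y = y) ∧ e '' T.space ⊆ g '' U := by
  -- the open submanifold `M'`
  haveI : ConnectedSpace M' := isConnected_iff_connectedSpace.1 hconn
  letI : ChartedSpace (EuclideanSpace ℝ (Fin n)) M' :=
    inferInstanceAs (ChartedSpace (EuclideanSpace ℝ (Fin n)) (⟨M', hM'o⟩ : TopologicalSpace.Opens Y))
  have hval : IsOpenEmbedding ((↑) : M' → Y) := hM'o.isOpenEmbedding_subtypeVal
  -- the data restricted to `M'`
  set U' : Set M' := (↑) ⁻¹' U with hU'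
  have hU'o : IsOpen U' := hUo.preimage continuous_subtype_val
  have hmono' : MonotonicallyConnected (n - 3) (univ : Set M') U' := hmono.preimage_subtypeVal hUM'
  have hre : ∀ z, e z ∈ M' := fun z => hrange ⟨z, rfl⟩
  set e' : EuclideanSpace ℝ (Fin n) → M' := M'.codRestrict e hre with he'
  have he'e : IsOpenEmbedding e' := by
    refine ⟨he.isEmbedding.codRestrict M' hre, ?_⟩
    have : range e' = (↑) ⁻¹' range e := by
      ext x
      constructor
      · rintro ⟨z, rfl⟩
        exact ⟨z, rfl⟩
      · rintro ⟨z, hz⟩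
        exact ⟨z, Subtype.ext hz⟩
    rw [this]
    exact he.isOpen_range.preimage continuous_subtype_val
  set C' : Set M' := (↑) ⁻¹' C with hC'
  have hC'c : IsCompact C' :=
    hval.isInducing.isCompact_preimage' hC (by
      rw [Subtype.range_coe]
      exact hCU.trans hUM')
  have hC'U : C' ⊆ U' := fun x hx => hCU hx
  -- engulfing in `M'`
  obtain ⟨g, ⟨K, hK, hgK⟩, hgC, hgT⟩ := hTL M' U' hU'o hmono' e' he'e T hT hcard C' hC'c hC'U
  obtain ⟨G, hGin, hGout⟩ := exists_homeomorph_extend_subtype hM'o g hK hgK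
  refine ⟨G, hGout, fun y hy => ?_, ?_⟩
  · have hyM : y ∈ M' := hUM' (hCU hy)
    rw [hGin y hyM, hgC ⟨y, hyM⟩ hy]
  · rintro _ ⟨z, hz, rfl⟩
    obtain ⟨w, hw, hwz⟩ := hgT ⟨z, hz, rfl⟩
    refine ⟨w, hw, ?_⟩
    rw [hGin w w.2]
    have : g w = e' z := by rw [← hwz]
    rw [Subtype.coe_eta, this]
    rfl

end Manifold

end Literature.Topology.FourManifolds

end
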